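import Mathlib.Algebra.Polynomial.Bivariate
import Mathlib.Algebra.Polynomial.Roots
import Mathlib.Algebra.Polynomial.Div
import Mathlib.Algebra.Order.GroupWithZero.Basic
import Mathlib.FieldTheory.RatFunc.Basic
import Mathlib.FieldTheory.IntermediateField.Adjoin.Basic
import Mathlib.RingTheory.Localization.Integral
import Mathlib.RingTheory.Algebraic.Integral
import Mathlib.RingTheory.PrincipalIdealDomain
import Mathlib.RingTheory.MvPolynomial.Basic
import Literature.NumberTheory.Transcendental.RoySmallValueEstimates
import HarnessLib

/-!
# Small value estimates at rational translates (Nguyen–Roy 2016) — proofs, I: the exact-vanishing case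

Companion ("Proofs") file of `RoySmallValueEstimates.lean`, working towards the named fact
`Literature.NumberTheory.Transcendental.nguyenRoy2016_thm_1` (Nguyen–Roy, *A small value estimate
in dimension two involving translations by rational points*, IJNT 12 (2016) = arXiv:1412.5163,
Theorem 1). Everything here is PROVED; no named facts are introduced.

## Content

The paper opens (§1, the paragraph before Theorem 1) with the remark that motivates the shape of
Theorem 1: *if a non-zero `P ∈ ℤ[X₁, X₂]` of degree `D` vanishes at the points
`(ξ + ir, η sⁱ)` for `i = 0, 1, …, D` (`η ≠ 0`, `r ∈ ℚˣ`, `s ∈ ℚ ∖ {0, ±1}`), then `ξ` and `η` are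
algebraic over `ℚ`*, and proves it at the end of §4 through **Lemma 13**: for the translation
automorphism `Φ(P)(X₀, X₁, X₂) = P(X₀, X₁ + rX₀, sX₂)`, the polynomials `P, Φ(P), …, Φ^D(P)` have no
common irreducible factor as soon as `P` (homogeneous of degree `D`) is divisible neither by `X₀`
nor by `X₂` — the only eigenvectors of a power `Φᵏ` (`k ≠ 0`) on forms of degree `t` are the
monomials `X₀^{t-i} X₂^i`, because the numbers `1, sᵏ, …, s^{tk}` are distinct. Since all the
`Φʲ(P)` vanish at `(ξ, η)`, that point lies on a zero-dimensional `ℚ`-subvariety, whence the claim.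
This is the algebraic skeleton of Theorem 1 (whose hypothesis is *smallness*, not vanishing, at
`4⌊D^σ⌋ > D + 1` translates, and whose proof needs in addition the zero estimate, interpolation
and height machinery of Roy 2013 = Mathematika 59); we prove it here:

* `NguyenRoy.isAlgebraic_of_aeval_translates_eq_zero` — the §1 remark, in the affine coordinates
  and the evaluation format (`MvPolynomial.aeval ![ξ + i r, η sⁱ]`) of `nguyenRoy2016_thm_1`.

Proof (a rephrasing of Lemma 13 that avoids Chow forms and unique factorisation, convenient in
Lean). Write `P` as `f ∈ ℚ[x][Y]` (`NguyenRoy.toXY`; `x` = first, `Y` = second coordinate), strip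
the power of `Y` dividing it (harmless as `η sⁱ ≠ 0`) and put `gⱼ = Φʲ(f)` with
`Φ(f)(x, Y) = f(x + r, sY)` (`NguyenRoy.PhiA`), so that `gⱼ(ξ, η) = f(ξ + jr, sʲη) = 0` for
`j ≤ D`. Over the field `K = ℚ(x)` (`RatFunc ℚ`, on which `Φ` acts through the shift
`NguyenRoy.shiftK`), the ideals `I_k = (g₀, …, g_k) ⊂ K[Y]` increase, their monic generators have
non-increasing degrees `d₀ ≥ d₁ ≥ … ≥ d_D` with `d₀ ≤ deg_Y f ≤ D`; if `I_D ≠ K[Y]` then `d_D ≥ 1`,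
so by the box principle `d_k = d_{k+1}` for some `k < D`, i.e. `I_k = I_{k+1} ∋ g_{k+1}`, which makes
`I_k` stable under `Φ`; its generator `z` is then an eigenvector of `Φ` (`Φ z = λ z`), and comparing
the coefficients of `Y⁰` and of `Y^{deg z}` (leading coefficients of numerators and denominators
are shift invariant) gives `s^{deg z} = 1`, impossible — unless `z(0) = 0`, i.e. `Y ∣ z ∣ f`,
excluded (`NguyenRoy.span_translates_eq_top`; this is Lemma 13 with the eigenvector argument run
on `Y`-coefficients in `ℚ(x)` instead of on forms). Hence `1 = ∑ uⱼ gⱼ` in `K[Y]`; clearing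
denominators, `B(x) = ∑ vⱼ gⱼ` with `0 ≠ B ∈ ℚ[x]`, `vⱼ ∈ ℚ[x][Y]`, and evaluating at `(ξ, η)` gives
`B(ξ) = 0`: `ξ` is algebraic. Finally some `gⱼ(ξ, Y) ∈ ℂ[Y]` is not the zero polynomial (otherwise
every `Y`-coefficient of `f`, a rational polynomial of degree `≤ D`, would vanish at the `D + 1`
distinct points `ξ + jr`), it has coefficients in the number field `ℚ(ξ)` and `η` as a root, so `η`
is algebraic as well.

## References

* [NguyenRoy2016] N. A. V. Nguyen, D. Roy, IJNT 12 (2016) 1273–1293 = arXiv:1412.5163: §1 (the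
  paragraph before Theorem 1), §2 (the automorphism `Φ`), Lemma 13 (§4) and the sentence before it.
-/

noncomputable section

open Polynomial
open scoped Polynomial.Bivariate

namespace Literature.NumberTheory.Transcendental

namespace NguyenRoy

/-! ### Dilations `Y ↦ tY`, shifts `x ↦ x + c`, and the translation morphism `Φ` -/

/-- The ring endomorphism `p(X) ↦ p(tX)` of `R[X]`. [folklore] -/
def dilate {R : Type*} [CommSemiring R] (t : R) : R[X] →+* R[X] :=
  eval₂RingHom C (C t * X)

/-- `p(tX)` has `i`-th coefficient `pᵢ tⁱ`. [folklore] -/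
theorem coeff_dilate {R : Type*} [CommSemiring R] (t : R) (p : R[X]) (i : ℕ) :
    (dilate t p).coeff i = p.coeff i * t ^ i := by
  simp only [dilate, coe_eval₂RingHom, eval₂_eq_sum, Polynomial.sum_def, finsetSum_coeff, mul_pow,
    ← C_pow, ← mul_assoc, ← C_mul, coeff_C_mul_X_pow]
  rw [Finset.sum_ite_eq]
  split_ifs with h
  · rfl
  · rw [notMem_support_iff.mp h, zero_mul]

/-- `dilate t (C a) = C a`. [folklore] -/
@[simp] theorem dilate_C {R : Type*} [CommSemiring R] (t a : R) : dilate t (C a) = C a := by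
  simp [dilate]

/-- `dilate t X = C t * X`. [folklore] -/
@[simp] theorem dilate_X {R : Type*} [CommSemiring R] (t : R) : dilate t X = C t * X := by
  simp [dilate]

/-- `X + C c` is not a constant polynomial. [folklore] -/
theorem X_add_C_ne_C (c d : ℚ) : (X + C c : ℚ[X]) ≠ C d := by
  intro h
  have := congrArg natDegree h
  simp at this

/-- Composition with `X + c` kills no non-zero polynomial. [folklore] -/
theorem comp_X_add_C_ne_zero {p : ℚ[X]} (hp : p ≠ 0) (c : ℚ) : p.comp (X + C c) ≠ 0 := by
  rw [Ne, comp_eq_zero_iff, not_or]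
  exact ⟨hp, fun h => X_add_C_ne_C c _ h.2⟩

/-- The shift `p(x) ↦ p(x + c)` maps non-zero-divisors of `ℚ[x]` to non-zero-divisors. [folklore] -/
theorem shift_le_comap (c : ℚ) :
    nonZeroDivisors ℚ[X] ≤ (nonZeroDivisors ℚ[X]).comap (compRingHom (X + C c)) := by
  intro p hp
  simp only [Submonoid.mem_comap, mem_nonZeroDivisors_iff_ne_zero, coe_compRingHom_apply] at hp ⊢
  exact comp_X_add_C_ne_zero hp c

/-- The field automorphism `w(x) ↦ w(x + c)` of `K = ℚ(x)` (as a ring endomorphism of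
`RatFunc ℚ`). [cite: NguyenRoy2016, §2 (the automorphism Φ)] -/
def shiftK (c : ℚ) : RatFunc ℚ →+* RatFunc ℚ :=
  RatFunc.mapRingHom (compRingHom (X + C c)) (shift_le_comap c)

/-- The shift of `ℚ(x)` extends the shift of `ℚ[x]`. [folklore] -/
theorem shiftK_algebraMap (c : ℚ) (q : ℚ[X]) :
    shiftK c (algebraMap ℚ[X] (RatFunc ℚ) q) =
      algebraMap ℚ[X] (RatFunc ℚ) (q.comp (X + C c)) := by
  have h := RatFunc.map_apply_div (compRingHom (X + C c)) (shift_le_comap c) q 1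
  simp only [map_one, div_one, coe_compRingHom_apply] at h
  rw [shiftK, RatFunc.coe_mapRingHom_eq_coe_map]
  exact h

/-- Nguyen–Roy's translation morphism in affine coordinates on `ℚ[x][Y]`:
`Φ(f)(x, Y) = f(x + r, sY)` (the paper's `Φ(P)(X₀, X₁, X₂) = P(X₀, X₁ + rX₀, sX₂)` dehomogenised
at `X₀ = 1`). [cite: NguyenRoy2016, §2 (the automorphism Φ)] -/
def PhiA (r s : ℚ) : ℚ[X][Y] →+* ℚ[X][Y] :=
  (dilate (C s)).comp (mapRingHom (compRingHom (X + C r)))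

/-- Coefficients of `Φ(f)`: `Φ(f)ᵢ(x) = fᵢ(x + r) sⁱ`. [cite: NguyenRoy2016, §2] -/
theorem coeff_PhiA (r s : ℚ) (p : ℚ[X][Y]) (i : ℕ) :
    (PhiA r s p).coeff i = (p.coeff i).comp (X + C r) * C s ^ i := by
  simp [PhiA, coeff_dilate, coeff_map]

/-- The same morphism on `K[Y]`, `K = ℚ(x)`: `Φ(f)(x, Y) = f(x + r, sY)`.
[cite: NguyenRoy2016, §2 (the automorphism Φ)] -/
def PhiK (r s : ℚ) : (RatFunc ℚ)[X] →+* (RatFunc ℚ)[X] :=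
  (dilate (algebraMap ℚ (RatFunc ℚ) s)).comp (mapRingHom (shiftK r))

/-- Coefficients of `Φ(f)` over `ℚ(x)`. [cite: NguyenRoy2016, §2] -/
theorem coeff_PhiK (r s : ℚ) (p : (RatFunc ℚ)[X]) (i : ℕ) :
    (PhiK r s p).coeff i = shiftK r (p.coeff i) * algebraMap ℚ (RatFunc ℚ) s ^ i := by
  simp [PhiK, coeff_dilate, coeff_map]

/-- `Φ` commutes with the inclusion `ℚ[x][Y] ⊂ ℚ(x)[Y]`. [folklore] -/
theorem map_PhiA (r s : ℚ) (p : ℚ[X][Y]) :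
    (PhiA r s p).map (algebraMap ℚ[X] (RatFunc ℚ)) =
      PhiK r s (p.map (algebraMap ℚ[X] (RatFunc ℚ))) := by
  ext i
  simp only [coeff_map, coeff_PhiA, coeff_PhiK, map_mul, map_pow, shiftK_algebraMap]
  congr 2
  rw [IsScalarTower.algebraMap_apply ℚ ℚ[X] (RatFunc ℚ) s, Polynomial.algebraMap_eq]

/-- `Φ` over `ℚ(x)` kills exactly the zero coefficients (`s ≠ 0`). [folklore] -/
theorem PhiK_coeff_eq_zero_iff (r s : ℚ) (hs : s ≠ 0) (p : (RatFunc ℚ)[X]) (i : ℕ) :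
    (PhiK r s p).coeff i = 0 ↔ p.coeff i = 0 := by
  rw [coeff_PhiK, mul_eq_zero, map_eq_zero_iff _ (shiftK r).injective, or_iff_left]
  exact pow_ne_zero _ ((map_ne_zero_iff _ (algebraMap ℚ (RatFunc ℚ)).injective).mpr hs)

/-- `Φ` preserves the degree in `Y` (`s ≠ 0`). [cite: NguyenRoy2016, §2] -/
theorem natDegree_PhiK (r s : ℚ) (hs : s ≠ 0) (p : (RatFunc ℚ)[X]) :
    (PhiK r s p).natDegree = p.natDegree := by
  apply le_antisymm
  · rw [natDegree_le_iff_coeff_eq_zero]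
    intro N hN
    rw [PhiK_coeff_eq_zero_iff r s hs]
    exact coeff_eq_zero_of_natDegree_lt hN
  · rw [natDegree_le_iff_coeff_eq_zero]
    intro N hN
    rw [← PhiK_coeff_eq_zero_iff r s hs]
    exact coeff_eq_zero_of_natDegree_lt hN

/-- `Φ` is injective on `ℚ(x)[Y]` (`s ≠ 0`). [folklore] -/
theorem PhiK_ne_zero (r s : ℚ) (hs : s ≠ 0) {p : (RatFunc ℚ)[X]} (hp : p ≠ 0) :
    PhiK r s p ≠ 0 := by
  intro h
  apply hp
  ext i
  rw [coeff_zero, ← PhiK_coeff_eq_zero_iff r s hs, h, coeff_zero]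

/-! ### Evaluation at complex points -/

/-- Evaluation `q ↦ q(a)` of `ℚ[x]` at `a ∈ ℂ`, as a ring homomorphism. [folklore] -/
def evx (a : ℂ) : ℚ[X] →+* ℂ := (aeval a : ℚ[X] →ₐ[ℚ] ℂ).toRingHom

/-- `evx a q = q(a)`. [folklore] -/
@[simp] theorem evx_apply (a : ℂ) (q : ℚ[X]) : evx a q = aeval a q := rfl

/-- `aevalAeval a b f = (f ↦ f(a, ·))(b)`: evaluation of `f ∈ ℚ[x][Y]` at `(a, b) ∈ ℂ²` is
evaluation at `b` of the slice `f(a, Y) ∈ ℂ[Y]`. [folklore] -/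
theorem aevalAeval_eq_eval_map (a b : ℂ) (p : ℚ[X][Y]) :
    aevalAeval a b p = (p.map (evx a)).eval b := by
  suffices h : (aevalAeval a b : ℚ[X][Y] →ₐ[ℚ] ℂ).toRingHom =
      (evalRingHom b).comp (mapRingHom (evx a)) from
    RingHom.congr_fun h p
  refine Polynomial.ringHom_ext (fun q => ?_) ?_
  · simp
  · simp

/-- **`Φ` is translation by `(r, s)`**: `Φ(f)(a, b) = f(a + r, sb)`.
[cite: NguyenRoy2016, §2 ("the map τ restricts to translation by (r,s)")] -/
theorem aevalAeval_PhiA (r s : ℚ) (a b : ℂ) (p : ℚ[X][Y]) :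
    aevalAeval a b (PhiA r s p) = aevalAeval (a + r) (s * b) p := by
  suffices h : ((aevalAeval a b : ℚ[X][Y] →ₐ[ℚ] ℂ).toRingHom.comp (PhiA r s)) =
      (aevalAeval (a + (r : ℂ)) ((s : ℂ) * b) : ℚ[X][Y] →ₐ[ℚ] ℂ).toRingHom from
    RingHom.congr_fun h p
  refine Polynomial.ringHom_ext (fun q => ?_) ?_
  · simp [PhiA, aeval_comp]
  · simp [PhiA]

/-- Iterating: `Φʲ(f)(a, b) = f(a + jr, sʲ b)`. [cite: NguyenRoy2016, §2] -/
theorem aevalAeval_iterate_PhiA (r s : ℚ) (a b : ℂ) (p : ℚ[X][Y]) (j : ℕ) :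
    aevalAeval a b ((PhiA r s)^[j] p) = aevalAeval (a + j * r) ((s : ℂ) ^ j * b) p := by
  induction j generalizing a b with
  | zero => simp
  | succ j ih =>
    rw [Function.iterate_succ_apply', aevalAeval_PhiA, ih]
    have h1 : a + (r : ℂ) + (j : ℂ) * r = a + ((j + 1 : ℕ) : ℂ) * r := by push_cast; ring
    have h2 : (s : ℂ) ^ j * ((s : ℂ) * b) = (s : ℂ) ^ (j + 1) * b := by ring
    rw [h1, h2]

/-- Slices: if `Φ(q)(a, Y) = 0` identically then `q(a + r, Y) = 0` identically (`s ≠ 0`).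
[folklore] -/
theorem map_evx_eq_zero_of_PhiA (r s : ℚ) (hs : s ≠ 0) (q : ℚ[X][Y]) (a : ℂ)
    (h : (PhiA r s q).map (evx a) = 0) : q.map (evx (a + r)) = 0 := by
  ext i
  have hi := congrArg (fun p => Polynomial.coeff p i) h
  simp only [coeff_map, coeff_PhiA, coeff_zero, evx_apply, map_mul, map_pow, aeval_comp,
    aeval_C, map_add, aeval_X, eq_ratCast] at hi
  simp only [coeff_map, evx_apply, coeff_zero]
  exact (mul_eq_zero.mp hi).resolve_right (pow_ne_zero _ (by exact_mod_cast hs))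

/-- Iterated slices: if `Φʲ(q)(a, Y) = 0` identically then `q(a + jr, Y) = 0` identically.
[folklore] -/
theorem map_evx_eq_zero_of_iterate_PhiA (r s : ℚ) (hs : s ≠ 0) (j : ℕ) (q : ℚ[X][Y]) (a : ℂ)
    (h : ((PhiA r s)^[j] q).map (evx a) = 0) : q.map (evx (a + j * r)) = 0 := by
  induction j generalizing q a with
  | zero => simpa using h
  | succ j ih =>
    rw [Function.iterate_succ_apply] at h
    have h' := map_evx_eq_zero_of_PhiA r s hs q _ (ih _ _ h)
    have e : a + ((j + 1 : ℕ) : ℂ) * r = a + (j : ℂ) * r + r := by push_cast; ring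
    rw [e]
    exact h'

/-! ### From `ℤ[X₁, X₂]` to `ℚ[x][Y]` -/

/-- The embedding `ℤ[X₁, X₂] → ℚ[x][Y]`, `X₁ ↦ x`, `X₂ ↦ Y` (indices `0, 1 : Fin 2`). [folklore] -/
def toXY : MvPolynomial (Fin 2) ℤ →+* ℚ[X][Y] :=
  MvPolynomial.eval₂Hom (Int.castRingHom _) ![C X, Y]

/-- Evaluations agree: `(toXY P)(a, b) = P(a, b)`. [folklore] -/
theorem aevalAeval_toXY (a b : ℂ) (P : MvPolynomial (Fin 2) ℤ) :
    aevalAeval a b (toXY P) = MvPolynomial.aeval ![a, b] P := by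
  suffices h : (aevalAeval a b : ℚ[X][Y] →ₐ[ℚ] ℂ).toRingHom.comp toXY =
      (MvPolynomial.aeval ![a, b] : MvPolynomial (Fin 2) ℤ →ₐ[ℤ] ℂ).toRingHom from
    RingHom.congr_fun h P
  refine MvPolynomial.ringHom_ext (fun n => by simp [toXY]) (fun i => ?_)
  fin_cases i <;> simp [toXY]

/-- Coefficients: the `xⁱ Yʲ`-coefficient of `toXY P` is the `X₁ⁱ X₂ʲ`-coefficient of `P`.
[folklore] -/
theorem coeff_toXY (P : MvPolynomial (Fin 2) ℤ) (i j : ℕ) :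
    ((toXY P).coeff j).coeff i =
      ((MvPolynomial.coeff (Finsupp.single (0 : Fin 2) i + Finsupp.single 1 j) P : ℤ) : ℚ) := by
  classical
  induction P using MvPolynomial.induction_on' with
  | monomial m c =>
    have hm : m = Finsupp.single 0 i + Finsupp.single 1 j ↔ (j = m 1 ∧ i = m 0) := by
      constructor
      · rintro rfl; simp
      · rintro ⟨h1, h0⟩; ext k; fin_cases k <;> simp [h0, h1]
    have hc : (Int.castRingHom ℚ[X][Y]) c = C (C (c : ℚ)) := by
      rw [eq_intCast, ← C_eq_intCast, ← C_eq_intCast]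
    simp only [toXY, MvPolynomial.coe_eval₂Hom, MvPolynomial.eval₂_monomial, Finsupp.prod_pow,
      Fin.prod_univ_two, Matrix.cons_val_zero, Matrix.cons_val_one, hc,
      MvPolynomial.coeff_monomial]
    rw [← C_pow, ← mul_assoc, ← C_mul, coeff_C_mul_X_pow]
    by_cases hj : j = m 1
    · rw [if_pos hj, coeff_C_mul_X_pow]
      by_cases hi : i = m 0
      · rw [if_pos hi, if_pos (hm.mpr ⟨hj, hi⟩)]
      · rw [if_neg hi, if_neg (fun h => hi (hm.mp h).2), Int.cast_zero]
    · rw [if_neg hj, coeff_zero, if_neg (fun h => hj (hm.mp h).1), Int.cast_zero]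
  | add p q hp hq => simp [hp, hq]

/-- `toXY` is injective. [folklore] -/
theorem toXY_ne_zero {P : MvPolynomial (Fin 2) ℤ} (hP : P ≠ 0) : toXY P ≠ 0 := by
  obtain ⟨m, hm⟩ := MvPolynomial.ne_zero_iff.mp hP
  have hm' : m = Finsupp.single 0 (m 0) + Finsupp.single 1 (m 1) := by
    ext k; fin_cases k <;> simp
  intro h
  have := coeff_toXY P (m 0) (m 1)
  rw [h, coeff_zero, coeff_zero, ← hm'] at this
  exact hm (by exact_mod_cast this.symm)

/-- A monomial `X₁ⁱ X₂ʲ` in the support of `P` has `i + j ≤ deg P`. [folklore] -/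
theorem add_le_totalDegree_of_coeff_toXY_ne_zero (P : MvPolynomial (Fin 2) ℤ) {i j : ℕ}
    (h : ((toXY P).coeff j).coeff i ≠ 0) : i + j ≤ P.totalDegree := by
  rw [coeff_toXY] at h
  have hmem : Finsupp.single 0 i + Finsupp.single 1 j ∈ P.support := by
    rw [MvPolynomial.mem_support_iff]
    exact_mod_cast h
  have := MvPolynomial.le_totalDegree hmem
  rwa [Finsupp.sum_add_index' (fun _ => rfl) (fun _ _ _ => rfl), Finsupp.sum_single_index rfl,
    Finsupp.sum_single_index rfl] at this

/-- `deg_Y (toXY P) ≤ deg P`. [folklore] -/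
theorem natDegree_toXY_le (P : MvPolynomial (Fin 2) ℤ) : (toXY P).natDegree ≤ P.totalDegree := by
  rw [natDegree_le_iff_coeff_eq_zero]
  intro N hN
  by_contra h
  obtain ⟨i, hi⟩ : ∃ i, ((toXY P).coeff N).coeff i ≠ 0 := by
    by_contra! hall
    exact h (Polynomial.ext fun i => by simpa using hall i)
  have := add_le_totalDegree_of_coeff_toXY_ne_zero P hi
  omega

/-- Every `Y`-coefficient of `toXY P` has `x`-degree `≤ deg P`. [folklore] -/
theorem natDegree_coeff_toXY_le (P : MvPolynomial (Fin 2) ℤ) (j : ℕ) :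
    ((toXY P).coeff j).natDegree ≤ P.totalDegree := by
  rw [natDegree_le_iff_coeff_eq_zero]
  intro N hN
  by_contra h
  have := add_le_totalDegree_of_coeff_toXY_ne_zero P h
  omega

/-! ### Lemma 13 over `ℚ(x)`: no eigenvectors, and the ideal of translates -/

/-- **Leading coefficients are shift invariant**: if `a, b ∈ ℚ(x)ˣ` and `t ∈ ℚ` satisfy
`a(x + c) b(x) t = b(x + c) a(x)`, then `t = 1` (compare the leading coefficients of numerators and
denominators). This is the computation behind "the restriction of `Φᵏ` to `X₂ⁱ ℂ[X₀, X₁]_{t−i}`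
admits `s^{ik}` as its only eigenvalue" in the proof of Lemma 13. [cite: NguyenRoy2016, Lemma 13] -/
theorem eq_one_of_shift_mul (c : ℚ) (a b : RatFunc ℚ) (ha : a ≠ 0) (hb : b ≠ 0) (t : ℚ)
    (h : shiftK c a * b * algebraMap ℚ (RatFunc ℚ) t = shiftK c b * a) : t = 1 := by
  set ι := algebraMap ℚ[X] (RatFunc ℚ) with hι_def
  have hι : Function.Injective ι := IsFractionRing.injective ℚ[X] (RatFunc ℚ)
  have hqa : a.denom ≠ 0 := RatFunc.denom_ne_zero a
  have hqb : b.denom ≠ 0 := RatFunc.denom_ne_zero b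
  have hpa : a.num ≠ 0 := RatFunc.num_ne_zero ha
  have hpb : b.num ≠ 0 := RatFunc.num_ne_zero hb
  have ha' : ι a.num / ι a.denom = a := RatFunc.num_div_denom a
  have hb' : ι b.num / ι b.denom = b := RatFunc.num_div_denom b
  have hsa : shiftK c a = ι (a.num.comp (X + C c)) / ι (a.denom.comp (X + C c)) := by
    conv_lhs => rw [← ha']
    rw [shiftK, RatFunc.coe_mapRingHom_eq_coe_map, RatFunc.map_apply_div]
    rfl
  have hsb : shiftK c b = ι (b.num.comp (X + C c)) / ι (b.denom.comp (X + C c)) := by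
    conv_lhs => rw [← hb']
    rw [shiftK, RatFunc.coe_mapRingHom_eq_coe_map, RatFunc.map_apply_div]
    rfl
  have ht : algebraMap ℚ (RatFunc ℚ) t = ι (C t) := by
    rw [IsScalarTower.algebraMap_apply ℚ ℚ[X] (RatFunc ℚ) t, Polynomial.algebraMap_eq]
  have h1 : ι (a.denom.comp (X + C c)) ≠ 0 := (map_ne_zero_iff ι hι).mpr (comp_X_add_C_ne_zero hqa c)
  have h2 : ι (b.denom.comp (X + C c)) ≠ 0 := (map_ne_zero_iff ι hι).mpr (comp_X_add_C_ne_zero hqb c)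
  have h3 : ι a.denom ≠ 0 := (map_ne_zero_iff ι hι).mpr hqa
  have h4 : ι b.denom ≠ 0 := (map_ne_zero_iff ι hι).mpr hqb
  have key : ι (a.num.comp (X + C c)) / ι (a.denom.comp (X + C c)) * (ι b.num / ι b.denom) *
      algebraMap ℚ (RatFunc ℚ) t =
      ι (b.num.comp (X + C c)) / ι (b.denom.comp (X + C c)) * (ι a.num / ι a.denom) := by
    rw [ha', hb', ← hsa, ← hsb]
    exact h
  rw [ht, div_mul_div_comm, div_mul_eq_mul_div, div_mul_div_comm,
    div_eq_div_iff (mul_ne_zero h1 h4) (mul_ne_zero h2 h3)] at key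
  simp only [← map_mul] at key
  have h := key
  have h' := hι h
  have hl := congrArg leadingCoeff h'
  have hX : (X + C c : ℚ[X]).natDegree ≠ 0 := by rw [natDegree_X_add_C]; exact one_ne_zero
  simp only [leadingCoeff_mul, leadingCoeff_comp hX, leadingCoeff_X_add_C, one_pow, mul_one,
    leadingCoeff_C] at hl
  have hne : a.num.leadingCoeff * b.num.leadingCoeff * (b.denom.leadingCoeff * a.denom.leadingCoeff)
      ≠ 0 := by
    refine mul_ne_zero (mul_ne_zero ?_ ?_) (mul_ne_zero ?_ ?_) <;>
      exact leadingCoeff_ne_zero.mpr ‹_›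
  apply mul_left_cancel₀ hne
  linear_combination hl

/-- `s ≠ 0, ±1` is not a root of unity in `ℚ`: `sⁿ = 1` forces `n = 0`. [folklore] -/
theorem pow_ne_one_of_ne (s : ℚ) (hs1 : s ≠ 1) (hs2 : s ≠ -1) {n : ℕ} (hn : n ≠ 0) :
    s ^ n ≠ 1 := by
  intro h
  have habs : |s| = 1 := by
    have := congrArg abs h
    rw [abs_pow, abs_one] at this
    exact (pow_eq_one_iff_of_nonneg (abs_nonneg s) hn).mp this
  rcases (abs_eq zero_le_one).mp habs with h' | h'
  · exact hs1 h'
  · exact hs2 h'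

/-- **The ideal of translates is the unit ideal** (the form of Nguyen–Roy's Lemma 13 used here).
Let `f ∈ ℚ(x)[Y]` be non-zero, not divisible by `Y`, of degree `≤ D` in `Y`, and let `r ≠ 0`,
`s ∉ {0, 1, −1}`. Then the translates `f, Φ(f), …, Φ^D(f)` (`Φ(f)(x, Y) = f(x + r, sY)`) generate
the unit ideal of `ℚ(x)[Y]`: the degrees of the generators of `(f, …, Φᵏ f)`, `k = 0, …, D`, cannot
strictly decrease `D` times from `≤ D` to `≥ 1`, and two consecutive equal ones produce a
`Φ`-stable principal ideal, whose generator would be an eigenvector of `Φ`, i.e. a monomial `Yⁱ`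
with `i ≥ 1` dividing `f`. [cite: NguyenRoy2016, Lemma 13] -/
theorem span_translates_eq_top (r s : ℚ) (hs : s ≠ 0) (hs1 : s ≠ 1) (hs2 : s ≠ -1)
    (f : (RatFunc ℚ)[X]) (hf : f ≠ 0) (hXf : ¬ X ∣ f) (D : ℕ) (hD : f.natDegree ≤ D) :
    Ideal.span (Set.range fun j : Fin (D + 1) => (PhiK r s)^[j] f) = ⊤ := by
  classical
  -- the translates and the increasing chain of ideals they generate
  set g : ℕ → (RatFunc ℚ)[X] := fun j => (PhiK r s)^[j] f with hg_def
  let I : ℕ → Ideal (RatFunc ℚ)[X] := fun k => Ideal.span (Set.range fun j : Fin (k + 1) => g j)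
  have hgI : ∀ {j k : ℕ}, j ≤ k → g j ∈ I k := fun {j k} hjk =>
    Ideal.subset_span ⟨⟨j, Nat.lt_succ_of_le hjk⟩, rfl⟩
  have hImono : ∀ {k l : ℕ}, k ≤ l → I k ≤ I l := by
    intro k l hkl
    refine Ideal.span_le.mpr ?_
    rintro _ ⟨j, rfl⟩
    exact hgI (by omega)
  -- their generators and degrees
  let gen : ℕ → (RatFunc ℚ)[X] := fun k => Submodule.IsPrincipal.generator (I k)
  have hgen_span : ∀ k, Ideal.span {gen k} = I k := fun k => Ideal.span_singleton_generator (I k)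
  have hgen_dvd : ∀ {k : ℕ} {x : (RatFunc ℚ)[X]}, x ∈ I k ↔ gen k ∣ x := fun {k x} => by
    rw [← Ideal.mem_span_singleton, hgen_span]
  have hgen_mem : ∀ k, gen k ∈ I k := fun k => Submodule.IsPrincipal.generator_mem (I k)
  have hg0 : g 0 = f := rfl
  have hgen_ne : ∀ k, gen k ≠ 0 := by
    intro k h
    have : g 0 ∈ I k := hgI (Nat.zero_le k)
    rw [hgen_dvd, h, zero_dvd_iff, hg0] at this
    exact hf this
  set d : ℕ → ℕ := fun k => (gen k).natDegree with hd_def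
  have hd_anti : ∀ {k l : ℕ}, k ≤ l → d l ≤ d k := fun {k l} hkl =>
    natDegree_le_of_dvd (hgen_dvd.mp (hImono hkl (hgen_mem k))) (hgen_ne k)
  have hd0 : d 0 ≤ D :=
    (natDegree_le_of_dvd (hgen_dvd.mp (hgI le_rfl)) (by rw [hg0]; exact hf)).trans
      (by rw [hg0]; exact hD)
  -- suppose the last ideal is proper: its generator has positive degree
  by_contra htop
  have hdD : 1 ≤ d D := by
    have hunit : ¬ IsUnit (gen D) := by
      intro hu
      apply htop
      change I D = ⊤
      rw [← hgen_span D]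
      exact Ideal.span_singleton_eq_top.mpr hu
    have := degree_pos_of_ne_zero_of_nonunit (hgen_ne D) hunit
    exact natDegree_pos_iff_degree_pos.mpr this
  -- box principle: two consecutive degrees agree
  obtain ⟨k, hkD, hk⟩ : ∃ k < D, d k = d (k + 1) := by
    by_contra! hne
    have hstrict : ∀ k < D, d (k + 1) < d k := fun k hk =>
      lt_of_le_of_ne (hd_anti (Nat.le_succ k)) (Ne.symm (hne k hk))
    have hsum : ∀ k ≤ D, d k + k ≤ d 0 := by
      intro k hk
      induction k with
      | zero => simp
      | succ k ih =>
        have := ih (Nat.le_of_succ_le hk)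
        have := hstrict k hk
        omega
    have := hsum D le_rfl
    omega
  -- hence `I k = I (k+1)` is stable under `Φ`
  have hIk : I (k + 1) = I k := by
    have hdvd : gen (k + 1) ∣ gen k := hgen_dvd.mp (hImono (Nat.le_succ k) (hgen_mem k))
    have hassoc : Associated (gen (k + 1)) (gen k) :=
      associated_of_dvd_of_natDegree_le hdvd (hgen_ne k) (le_of_eq hk)
    rw [← hgen_span, ← hgen_span k, Ideal.span_singleton_eq_span_singleton]
    exact hassoc
  have hPhiI : Ideal.map (PhiK r s) (I k) ≤ I k := by
    change Ideal.map (PhiK r s) (Ideal.span _) ≤ _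
    rw [Ideal.map_span]
    refine Ideal.span_le.mpr ?_
    rintro _ ⟨_, ⟨j, rfl⟩, rfl⟩
    have hj : PhiK r s (g j) = g (j + 1) := (Function.iterate_succ_apply' (PhiK r s) j f).symm
    rw [hj]
    change g (j + 1) ∈ I k
    rw [← hIk]
    exact hgI (by omega)
  -- so its generator `z` is an eigenvector of `Φ`
  set z := gen k with hz_def
  have hz : z ∣ PhiK r s z := hgen_dvd.mp (hPhiI (Ideal.mem_map_of_mem _ (hgen_mem k)))
  have hassoc : Associated z (PhiK r s z) :=
    associated_of_dvd_of_natDegree_le hz (PhiK_ne_zero r s hs (hgen_ne k))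
      (le_of_eq (natDegree_PhiK r s hs _))
  obtain ⟨u, hu⟩ := hassoc
  obtain ⟨c, -, hcu⟩ := Polynomial.isUnit_iff.mp u.isUnit
  have hcoef : ∀ i, shiftK r (z.coeff i) * algebraMap ℚ (RatFunc ℚ) s ^ i = z.coeff i * c := by
    intro i
    have := congrArg (fun q => Polynomial.coeff q i) hu
    simp only [← hcu, coeff_mul_C, coeff_PhiK] at this
    exact this.symm
  -- `z(0) ≠ 0` since `Y ∤ f`
  have hz0 : z.coeff 0 ≠ 0 := by
    intro h0
    apply hXf
    have hXz : X ∣ z := X_dvd_iff.mpr h0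
    rw [← hg0]
    exact hXz.trans (hgen_dvd.mp (hgI (Nat.zero_le k)))
  -- and `deg z ≥ 1`
  have hn : 1 ≤ z.natDegree := hdD.trans (hd_anti hkD.le)
  have hzn : z.coeff z.natDegree ≠ 0 := by
    rw [coeff_natDegree]
    exact leadingCoeff_ne_zero.mpr (hgen_ne k)
  -- compare the coefficients of `Y⁰` and `Y^{deg z}`
  have h0 := hcoef 0
  rw [pow_zero, mul_one] at h0
  have hN := hcoef z.natDegree
  have key : shiftK r (z.coeff z.natDegree) * z.coeff 0 *
      algebraMap ℚ (RatFunc ℚ) (s ^ z.natDegree) = shiftK r (z.coeff 0) * z.coeff z.natDegree := by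
    rw [map_pow]
    calc shiftK r (z.coeff z.natDegree) * z.coeff 0 * algebraMap ℚ (RatFunc ℚ) s ^ z.natDegree
        = (shiftK r (z.coeff z.natDegree) * algebraMap ℚ (RatFunc ℚ) s ^ z.natDegree) *
            z.coeff 0 := by ring
      _ = z.coeff z.natDegree * c * z.coeff 0 := by rw [hN]
      _ = (z.coeff 0 * c) * z.coeff z.natDegree := by ring
      _ = shiftK r (z.coeff 0) * z.coeff z.natDegree := by rw [← h0]
  have hsn := eq_one_of_shift_mul r (z.coeff z.natDegree) (z.coeff 0) hzn hz0 _ key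
  exact pow_ne_one_of_ne s hs1 hs2 (by omega) hsn

/-! ### The exact-vanishing case of Theorem 1 -/

/-- **Clearing denominators in Lemma 13**: for `f ∈ ℚ[x][Y]` non-zero, not divisible by `Y`, of
`Y`-degree `≤ D`, some non-zero `B ∈ ℚ[x]` is a `ℚ[x][Y]`-combination of the translates
`f, Φ(f), …, Φ^D(f)`. [cite: NguyenRoy2016, Lemma 13 and the sentence before it] -/
theorem exists_C_eq_sum_mul_iterate_PhiA (r s : ℚ) (hs : s ≠ 0) (hs1 : s ≠ 1)
    (hs2 : s ≠ -1) (f : ℚ[X][Y]) (hf : f ≠ 0) (hXf : ¬ X ∣ f) (D : ℕ) (hD : f.natDegree ≤ D) :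
    ∃ (B : ℚ[X]) (v : Fin (D + 1) → ℚ[X][Y]), B ≠ 0 ∧ ∑ j, v j * (PhiA r s)^[j] f = C B := by
  classical
  set ι := algebraMap ℚ[X] (RatFunc ℚ) with hι_def
  have hι : Function.Injective ι := IsFractionRing.injective ℚ[X] (RatFunc ℚ)
  have hgK : ∀ j : ℕ, ((PhiA r s)^[j] f).map ι = (PhiK r s)^[j] (f.map ι) := by
    intro j
    induction j with
    | zero => rfl
    | succ j ih =>
      rw [Function.iterate_succ_apply', Function.iterate_succ_apply', map_PhiA, ← ih]
  have htop := span_translates_eq_top r s hs hs1 hs2 (f.map ι)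
    ((Polynomial.map_ne_zero_iff hι).mpr hf)
    (by rwa [X_dvd_iff, coeff_map, map_eq_zero_iff ι hι, ← X_dvd_iff]) D
    (by rwa [natDegree_map_eq_of_injective hι])
  have h1 : (1 : (RatFunc ℚ)[X]) ∈
      Ideal.span (Set.range fun j : Fin (D + 1) => (PhiK r s)^[j] (f.map ι)) := by
    rw [htop]; trivial
  obtain ⟨u, hu⟩ := Ideal.mem_span_range_iff_exists_fun.mp h1
  -- clear denominators
  choose b hbM hb using fun j : Fin (D + 1) =>
    IsLocalization.integerNormalization_spec (nonZeroDivisors ℚ[X]) (u j)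
  have hb0 : ∀ j, b j ≠ 0 := fun j => nonZeroDivisors.ne_zero (hbM j)
  refine ⟨∏ j, b j, fun j => C (∏ j' ∈ Finset.univ.erase j, b j') *
    IsLocalization.integerNormalization (nonZeroDivisors ℚ[X]) (u j),
    Finset.prod_ne_zero_iff.mpr fun j _ => hb0 j, ?_⟩
  apply Polynomial.map_injective ι hι
  rw [Polynomial.map_sum, Polynomial.map_C]
  have hvj : ∀ j : Fin (D + 1),
      (C (∏ j' ∈ Finset.univ.erase j, b j') *
        IsLocalization.integerNormalization (nonZeroDivisors ℚ[X]) (u j) * (PhiA r s)^[j] f).map ι =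
      C (ι (∏ j, b j)) * (u j * (PhiK r s)^[j] (f.map ι)) := by
    intro j
    rw [Polynomial.map_mul, Polynomial.map_mul, Polynomial.map_C, hb j, hgK j, Algebra.smul_def,
      Polynomial.algebraMap_apply, ← Finset.prod_erase_mul _ _ (Finset.mem_univ j), map_mul, C_mul]
    ring
  simp_rw [hvj, ← Finset.mul_sum, hu, mul_one]

/-- **The second coordinate**: if `ξ` is algebraic, `f ∈ ℚ[x][Y]` is non-zero with all
`Y`-coefficients of `x`-degree `≤ D`, and the translates `Φʲ(f)`, `j ≤ D`, vanish at `(ξ, η)`, then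
`η` is algebraic: some slice `Φʲ(f)(ξ, Y)` is a non-zero polynomial over the number field `ℚ(ξ)`
(otherwise every coefficient of `f` would have the `D + 1` roots `ξ + jr`) with root `η`.
[cite: NguyenRoy2016, §1 (paragraph before Theorem 1)] -/
theorem isAlgebraic_snd_of_aevalAeval_iterate_eq_zero (ξ η : ℂ) (hξ : IsAlgebraic ℚ ξ) (r s : ℚ)
    (hr : r ≠ 0) (hs : s ≠ 0) (D : ℕ) (f : ℚ[X][Y]) (hf : f ≠ 0)
    (hdeg : ∀ i, (f.coeff i).natDegree ≤ D)
    (hvan : ∀ j ≤ D, aevalAeval ξ η ((PhiA r s)^[j] f) = 0) : IsAlgebraic ℚ η := by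
  classical
  -- some slice `Φʲ(f)(ξ, Y)` is a non-zero polynomial (root counting in `x`)
  have hslice : ∃ j ≤ D, ((PhiA r s)^[j] f).map (evx ξ) ≠ 0 := by
    by_contra! hall
    apply hf
    refine Polynomial.ext fun i => ?_
    rw [coeff_zero]
    have hroots : ∀ j : Fin (D + 1), ((f.coeff i).map (algebraMap ℚ ℂ)).eval (ξ + j * r) = 0 := by
      intro j
      have h := map_evx_eq_zero_of_iterate_PhiA r s hs j f ξ (hall j (Nat.lt_succ_iff.mp j.2))
      have := congrArg (fun p => Polynomial.coeff p i) h
      simpa [coeff_map, aeval_def, eval_map] using this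
    have hinj : Function.Injective (fun j : Fin (D + 1) => ξ + (j : ℂ) * r) := by
      intro j j' h
      have hr' : (r : ℂ) ≠ 0 := by exact_mod_cast hr
      have h' : (j : ℂ) = j' := mul_right_cancel₀ hr' (add_left_cancel h)
      exact Fin.ext (by exact_mod_cast h')
    have hdegi : ((f.coeff i).map (algebraMap ℚ ℂ)).natDegree < Fintype.card (Fin (D + 1)) := by
      rw [natDegree_map_eq_of_injective (algebraMap ℚ ℂ).injective, Fintype.card_fin]
      exact Nat.lt_succ_of_le (hdeg i)
    have h0 := eq_zero_of_natDegree_lt_card_of_eval_eq_zero _ hinj hroots hdegi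
    rwa [Polynomial.map_eq_zero_iff (algebraMap ℚ ℂ).injective] at h0
  obtain ⟨j, hj, hne⟩ := hslice
  -- that slice has coefficients in the number field `ℚ(ξ)` and `η` as a root
  let F : IntermediateField ℚ ℂ := IntermediateField.adjoin ℚ {ξ}
  let ξF : F := IntermediateField.AdjoinSimple.gen ℚ ξ
  haveI : FiniteDimensional ℚ F := IntermediateField.adjoin.finiteDimensional hξ.isIntegral
  set hF : F[X] := ((PhiA r s)^[j] f).map (aeval ξF : ℚ[X] →ₐ[ℚ] F).toRingHom with hF_def
  have hmap : hF.map (algebraMap F ℂ) = ((PhiA r s)^[j] f).map (evx ξ) := by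
    rw [hF_def, Polynomial.map_map]
    congr 1
    refine RingHom.ext fun q => ?_
    change algebraMap F ℂ (aeval ξF q) = aeval ξ q
    rw [← aeval_algebraMap_apply, IntermediateField.AdjoinSimple.algebraMap_gen]
  have hF0 : hF ≠ 0 := fun h => hne (by rw [← hmap, h, Polynomial.map_zero])
  have hroot : aeval η hF = 0 := by
    rw [aeval_def, ← eval_map, hmap, ← aevalAeval_eq_eval_map]
    exact hvan j hj
  have halg : IsAlgebraic F η := ⟨hF, hF0, hroot⟩
  have hint : IsIntegral F η := halg.isIntegral
  haveI : Algebra.IsIntegral ℚ F := Algebra.IsIntegral.of_finite ℚ F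
  exact (isIntegral_trans η hint).isAlgebraic

/-- **Nguyen–Roy 2016, §1 (the remark before Theorem 1), proved via Lemma 13.** Let
`ξ ∈ ℂ`, `η ∈ ℂˣ`, `r ∈ ℚˣ`, `s ∈ ℚ ∖ {0, 1, −1}`, and let `P ∈ ℤ[X₁, X₂]` be non-zero of (total)
degree `≤ D`. If `P(ξ + ir, η sⁱ) = 0` for `i = 0, 1, …, D`, then `ξ` and `η` are algebraic over
`ℚ`. ("We first note that, if `P` has degree `D` and vanishes at the point `(ξ + ir, η sⁱ)` for
`i = 0, 1, …, D`, then `ξ` and `η` must be algebraic over `ℚ` (see the short argument at the end of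
Section 4)." — the exact-vanishing skeleton of `nguyenRoy2016_thm_1`, in the same coordinates and
evaluation format.) [cite: NguyenRoy2016, §1 (paragraph before Theorem 1) and Lemma 13] -/
theorem isAlgebraic_of_aeval_translates_eq_zero (ξ η : ℂ) (hη : η ≠ 0) (r s : ℚ) (hr : r ≠ 0)
    (hs : s ≠ 0) (hs1 : s ≠ 1) (hs2 : s ≠ -1) (D : ℕ) (P : MvPolynomial (Fin 2) ℤ) (hP : P ≠ 0)
    (hdeg : P.totalDegree ≤ D)
    (hvan : ∀ i : ℕ, i ≤ D →
      MvPolynomial.aeval ![ξ + (i : ℂ) * (r : ℂ), η * (s : ℂ) ^ i] P = 0) :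
    IsAlgebraic ℚ ξ ∧ IsAlgebraic ℚ η := by
  classical
  -- `f = toXY P = Y^k f₁` with `Y ∤ f₁`; the values `f₁(ξ + jr, sʲη)`, `j ≤ D`, vanish
  have hf0 : toXY P ≠ 0 := toXY_ne_zero hP
  obtain ⟨f₁, hf, hX⟩ := exists_eq_pow_rootMultiplicity_mul_and_not_dvd (toXY P) hf0 0
  simp only [map_zero, sub_zero] at hf hX
  set k : ℕ := rootMultiplicity 0 (toXY P) with hk_def
  have hf₁0 : f₁ ≠ 0 := by
    rintro rfl
    rw [mul_zero] at hf
    exact hf0 hf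
  have hcoeff : ∀ i, f₁.coeff i = (toXY P).coeff (i + k) := fun i => by
    rw [hf, coeff_X_pow_mul]
  have hdeg₁ : f₁.natDegree ≤ D :=
    (natDegree_le_of_dvd (Dvd.intro_left _ hf.symm) hf0).trans ((natDegree_toXY_le P).trans hdeg)
  have hvan₁ : ∀ j ≤ D, aevalAeval ξ η ((PhiA r s)^[j] f₁) = 0 := by
    intro j hj
    have h := hvan j hj
    rw [← aevalAeval_toXY, hf, map_mul, map_pow, aevalAeval_Y, mul_comm η] at h
    have hb : ((s : ℂ) ^ j * η) ^ k ≠ 0 :=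
      pow_ne_zero _ (mul_ne_zero (pow_ne_zero _ (by exact_mod_cast hs)) hη)
    rw [aevalAeval_iterate_PhiA]
    exact (mul_eq_zero.mp h).resolve_left hb
  -- `ξ`: Lemma 13 + clearing denominators + evaluation at `(ξ, η)`
  have hξ : IsAlgebraic ℚ ξ := by
    obtain ⟨B, v, hB0, hsum⟩ :=
      exists_C_eq_sum_mul_iterate_PhiA r s hs hs1 hs2 f₁ hf₁0 hX D hdeg₁
    refine ⟨B, hB0, ?_⟩
    have hev := congrArg (aevalAeval ξ η) hsum
    rw [aevalAeval_C, map_sum] at hev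
    rw [← hev]
    exact Finset.sum_eq_zero fun j _ => by rw [map_mul, hvan₁ j (Nat.lt_succ_iff.mp j.2), mul_zero]
  -- `η`: root counting and the number field `ℚ(ξ)`
  refine ⟨hξ, isAlgebraic_snd_of_aevalAeval_iterate_eq_zero ξ η hξ r s hr hs D f₁ hf₁0
    (fun i => ?_) hvan₁⟩
  rw [hcoeff]
  exact (natDegree_coeff_toXY_le P _).trans hdeg

end NguyenRoy

end Literature.NumberTheory.Transcendental
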